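import Summits.ValiantsHypothesis.ValiantsHypothesis.Theorems.VPBoundarySquareCoeffQueryFP
import Literature.Computability.AlgebraicComplexity.VNPClosedUnderComposition
import Literature.Computability.AlgebraicComplexity.CoeffDefinable
import Literature.Computability.AlgebraicComplexity.BurgisserThm41Proofs
import Literature.Computability.Complexity.CircuitClassesUniformProofs
import Literature.Computability.Complexity.LengthCompare
import Literature.Computability.Complexity.IntPairBricks
import HarnessLib

/-!
# Valiant's criterion with `P/poly` coefficient functions — general p-families, binary model

Route-independent.  The library form of Valiant's criterion in the tree
(`Literature/…/ValiantCriterion.lean`, `isVNPFamily_circuitSum`) covers multilinear families with a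
`0/1` coefficient function given by circuits.  This file proves the general statement used
throughout the definability programme (Bürgisser 2000, Prop. 2.20; Koiran–Perifel 2007/2011;
Bürgisser 2024 survey, Prop. 2.27): **a p-family of integer polynomials with polynomial bitsize
whose coefficient function lies in `P/poly` is in `VNP` over every commutative ring** — with NO
collapse hypothesis:

* `isVNPFamily_map_of_hasCoeffFnIn_PPoly` — coefficient function in Bürgisser's 2026 query format
  `HasCoeffFnIn PPoly` (`expCoeffQuery`, `Literature/…/Bur26CountingClassVCH.lean`);
* `hasCoeffFnIn_PPoly_of_isCoeffDefinableIn` — the format bridge from the sign/bit languages of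
  `IsCoeffDefinableIn PPoly` (`Literature/…/CoeffDefinable.lean`, Koiran–Perifel format) to
  `HasCoeffFnIn PPoly`, by two `CodeFP` re-pairings and the Boolean closure of `P/poly`;
* `isVNPFamily_map_of_isCoeffDefinableIn_PPoly` — the criterion in the `IsCoeffDefinableIn PPoly`
  format (the hypothesis shape `hVC` of `Theorems/DefinabilityGapCHCut.lean`, here for
  `Fin`-indexed families).

Mechanism (no new circuit construction): Kronecker-pack `Qₙ` with digit base `2^δ`,
`δₙ = size(deg Qₙ + tₙ + 1) + 1` (`Theorems/VPBoundarySquareKroneckerVNP.lean`), translate the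
`P/poly` coefficient language into Tavenas' univariate query format
(`Theorems/VPBoundarySquareCoeffQueryFP.lean`, `exists_encUQuery_language`), package the result as
`DefVNP.FamilyData` (`exists_familyData`), invoke the tree's univariate `VNP`-witness
`DefVNP.isVNPFamily_hPoly` (Tavenas 2014, Prop. 3.17), and substitute `x_{δ i + j} ↦ Xᵢ^{2^j}`,
`z_ℓ ↦ 2^{2^ℓ}` (`aeval_theta_hPoly`) — a substitution of p-bounded degree `≤ 2^{δ-1} ≤ 2·(deg+t+1)`
and cost `≤ (uδ)δ`, under which `VNP` is closed (`IsVNPFamily.aeval`, Bürgisser 2024, §3.1).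

[cite: Burgisser2000, Prop. 2.20] [cite: Tavenas2014, Prop. 3.17]
[cite: Burgisser2026HNC, Def. 4.2 and Lemma 4.11 (pp. 11–13)]
-/

noncomputable section

set_option linter.dupNamespace false

open MvPolynomial
open Literature.Computability.AlgebraicComplexity
open Literature.Computability.Complexity

namespace Summit.ValiantsHypothesis.ValiantsHypothesis.Theorems.VPBoundarySquareValiantCriterionPPoly

open Summit.ValiantsHypothesis.ValiantsHypothesis.Theorems.VPBoundarySquareKroneckerVNP
open Summit.ValiantsHypothesis.ValiantsHypothesis.Theorems.VPBoundarySquareCoeffQueryFP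

/-! ## §1  Packaging a `P/poly`-definable integer family as Tavenas' `FamilyData` -/

section Packaging

/-- **Packaging.**  For p-bounded arity `u`, digit budget `δ` and bit budget `r < δ` with
`|coeff| < 2^{2^r}`, a family `Q` whose coefficient function (Bürgisser's query format) lies in
`P/poly` yields Tavenas' data `Φ` for the Kronecker-packed univariate family
`Φ.f n = kron (2^{δₙ}) Qₙ`, with `Φ.d n = uₙ δₙ` bit variables and `Φ.r n = rₙ`.
[cite: Tavenas2014, Prop. 3.17] [cite: Burgisser2026HNC, Lemma 4.11 (p. 13)] -/
theorem exists_familyData {u : ℕ → ℕ} (δ r : ℕ → ℕ) (hu : IsPBounded u) (hδ : IsPBounded δ)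
    (hr : IsPBounded r) (Q : ∀ n, MvPolynomial (Fin (u n)) ℤ)
    (hcoef : ∀ n e, (coeff e (Q n)).natAbs < 2 ^ 2 ^ r n) (hrδ : ∀ n, r n < δ n)
    (hco : HasCoeffFnIn PPoly Q) :
    ∃ Φ : DefVNP.FamilyData, (∀ n, Φ.f n = kron (2 ^ δ n) (Q n)) ∧ (∀ n, Φ.d n = u n * δ n) ∧
      ∀ n, Φ.r n = r n := by
  classical
  obtain ⟨L, hL, hLQ⟩ := hco
  have hud : IsPBounded fun n => u n * δ n := IsPBounded.mul_holds hu hδ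
  obtain ⟨pp, hpp⟩ := (isPBounded_iff_exists_polynomial_holds _).1 hud
  -- the overflow bit `2^(δ n)` of every coefficient is `false`
  have hfalse : ∀ n, coeffFnBit (Q n) 0 (2 ^ δ n) = false := by
    intro n
    obtain ⟨a, ha⟩ : ∃ a, 2 ^ δ n = a + 1 :=
      ⟨2 ^ δ n - 1, by have := Nat.one_le_two_pow (n := δ n); omega⟩
    rw [ha]
    show (coeff 0 (Q n)).natAbs.testBit a = false
    apply Nat.testBit_lt_two_pow
    refine (hcoef n 0).trans_le (Nat.pow_le_pow_right two_pos ?_)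
    have h2 : 2 ^ r n < 2 ^ δ n := Nat.pow_lt_pow_right (by norm_num) (hrδ n)
    omega
  obtain ⟨B, hB, hBQ⟩ := exists_encUQuery_language δ hu hδ Q hL hLQ hfalse
  obtain ⟨pB, hSIZE⟩ := Set.mem_iUnion.1 hB
  obtain ⟨CF, hCF, hdec⟩ := hSIZE
  refine ⟨{ f := fun n => kron (2 ^ δ n) (Q n)
            d := fun n => u n * δ n
            r := r
            hd := hud
            hr := hr
            p := pp
            B := B
            pB := pB
            CF := CF
            hCF := hCF
            hdec := hdec
            hp := fun n => (natDegree_kron_lt (Q n) (by positivity)).trans_le (by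
              rw [← pow_mul, mul_comm]
              exact Nat.pow_le_pow_right two_pos (hpp n))
            hB := fun n α j hα => ?_
            hdeg := fun n => by
              show (kron (2 ^ δ n) (Q n)).natDegree < 2 ^ (u n * δ n)
              rw [mul_comm, pow_mul]
              exact natDegree_kron_lt (Q n) (by positivity)
            hcoeff := fun n α => natAbs_coeff_kron_le (Q n) α (hcoef n) },
    fun _ => rfl, fun _ => rfl, fun _ => rfl⟩
  show encUQuery n α j ∈ B ↔ sbit ((kron (2 ^ δ n) (Q n)).coeff α) j = true
  rw [hBQ n α j]
  constructor
  · rintro ⟨hlt, hbit⟩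
    rw [coeff_kron_of_lt (Q n) hlt, fs_symm_eq_dig hlt, sbit_coeff_eq_coeffFnBit]
    exact hbit
  · intro h
    by_cases hlt : α < (2 ^ δ n) ^ u n
    · rw [coeff_kron_of_lt (Q n) hlt, fs_symm_eq_dig hlt, sbit_coeff_eq_coeffFnBit] at h
      exact ⟨hlt, h⟩
    · rw [coeff_kron, dif_neg hlt] at h
      cases j <;> simp [sbit] at h

end Packaging

/-! ## §2  The criterion in Bürgisser's query format -/

section Criterion

variable (k : Type*) [CommRing k]

/-- `(X i)^m` has total degree `≤ m` (no nontriviality assumption). -/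
theorem totalDegree_X_pow_le {σ : Type*} (i : σ) (m : ℕ) :
    (X i ^ m : MvPolynomial σ k).totalDegree ≤ m := by
  rcases subsingleton_or_nontrivial k with hk | hk
  · rw [Subsingleton.elim (X i ^ m : MvPolynomial σ k) 0, totalDegree_zero]
    exact Nat.zero_le _
  · exact (totalDegree_X_pow i m).le

/-- **Valiant's criterion, `P/poly` coefficients, binary model.**  A p-family `Q` of integer
polynomials with p-bounded coefficient bitsize whose coefficient function
(`expCoeffQuery n e a ↦ coeffFnBit Qₙ e a`) lies in `P/poly` is in `VNP` over every commutative
ring: `(map ℤ→k Qₙ)ₙ ∈ VNP_k`.  No collapse hypothesis.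
[cite: Burgisser2000, Prop. 2.20] [cite: Tavenas2014, Prop. 3.17] [cite: Burgisser2026HNC, Lemma 4.11 (p. 13)] -/
theorem isVNPFamily_map_of_hasCoeffFnIn_PPoly {u : ℕ → ℕ} {Q : ∀ n, MvPolynomial (Fin (u n)) ℤ}
    (hQ : IsPFamily Q) (ht : ∃ t : ℕ → ℕ, IsPBounded t ∧ ∀ n e, (coeff e (Q n)).natAbs < 2 ^ t n)
    (hco : HasCoeffFnIn PPoly Q) :
    IsVNPFamily fun n => map (Int.castRingHom k) (Q n) := by
  classical
  obtain ⟨t, htb, htQ⟩ := ht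
  have hu : IsPBounded u := hQ.1.mono fun n => by simp
  -- budgets: `M = deg + t + 1`, digit base `2^δ` with `δ = size M + 1`, bit budget `r = size t`
  let M : ℕ → ℕ := fun n => (Q n).totalDegree + t n + 1
  have hMb : IsPBounded M :=
    IsPBounded.add_holds (IsPBounded.add_holds hQ.2 htb) (IsPBounded.const 1)
  let δ : ℕ → ℕ := fun n => Nat.size (M n) + 1
  let r : ℕ → ℕ := fun n => Nat.size (t n)
  have hsizeM : ∀ n, Nat.size (M n) ≤ M n := fun n => Nat.size_le.2 (Nat.lt_two_pow_self)
  have hδ : IsPBounded δ :=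
    (IsPBounded.add_holds hMb (IsPBounded.const 1)).mono fun n => Nat.add_le_add_right (hsizeM n) 1
  have hr : IsPBounded r := htb.mono fun n => Nat.size_le.2 (Nat.lt_two_pow_self)
  have hrδ : ∀ n, r n < δ n := fun n =>
    Nat.lt_succ_of_le (Nat.size_le_size (by simp only [M]; omega))
  have hcoef : ∀ n e, (coeff e (Q n)).natAbs < 2 ^ 2 ^ r n := fun n e =>
    (htQ n e).trans_le (Nat.pow_le_pow_right two_pos (Nat.lt_size_self (t n)).le)
  -- the power `2^(size M) ≤ 2 M` (used for the degree of the substitution)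
  have hpowM : ∀ n, 2 ^ Nat.size (M n) ≤ 2 * M n := by
    intro n
    have hM1 : 1 ≤ M n := by simp only [M]; omega
    have hs1 : 1 ≤ Nat.size (M n) := Nat.lt_size.2 (by simpa using hM1)
    have h := Nat.lt_size.1 (show Nat.size (M n) - 1 < Nat.size (M n) by omega)
    calc 2 ^ Nat.size (M n) = 2 * 2 ^ (Nat.size (M n) - 1) := by
          rw [← pow_succ']; congr 1; omega
      _ ≤ 2 * M n := Nat.mul_le_mul_left 2 h
  obtain ⟨Φ, hΦf, hΦd, hΦr⟩ := exists_familyData δ r hu hδ hr Q hcoef hrδ hco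
  -- Tavenas: `hPoly Φ ∈ VNP`
  have hVNP : IsVNPFamily (σ := fun n => DefVNP.XZ (DefVNP.params Φ n)) (DefVNP.hPoly (k := k) Φ) :=
    DefVNP.isVNPFamily_hPoly Φ
  -- the substitution `theta` has p-bounded degree and cost
  let g : ∀ n, DefVNP.XZ (DefVNP.params Φ n) → MvPolynomial (Fin (u n)) k :=
    fun n => theta k Φ n (hΦd n) X
  have hgd : IsPBounded fun n => Finset.univ.sup fun v => (g n v).totalDegree := by
    refine (IsPBounded.mul_holds (IsPBounded.const 2) hMb).mono fun n => ?_
    refine (Finset.sup_le fun v _ => ?_).trans (hpowM n)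
    rcases v with t | l
    · simp only [g, theta_inl]
      refine (totalDegree_X_pow_le k _ _).trans (Nat.pow_le_pow_right two_pos ?_)
      have := (finProdFinEquiv.symm (Fin.cast (hΦd n) t)).2.isLt
      simp only [δ] at this
      omega
    · simp only [g, theta_inr, MvPolynomial.algebraMap_eq, totalDegree_C]
      exact Nat.zero_le _
  have hgc : IsPBounded fun n => ∑ v, complexity (g n v) := by
    refine (IsPBounded.mul_holds (IsPBounded.mul_holds hu hδ) hδ).mono fun n => ?_
    have hs := sum_complexity_theta_le (k := k) Φ n (hΦd n) (X : Fin (u n) → MvPolynomial (Fin (u n)) k)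
      (fun i => complexity_X_holds i)
    rw [hΦd n] at hs
    exact hs
  have key : (fun n => map (Int.castRingHom k) (Q n)) = fun n => aeval (g n) (DefVNP.hPoly (k := k) Φ n) := by
    funext n
    simp only [g]
    rw [aeval_theta_hPoly k Φ n (hΦd n) (Q n) (hΦf n) ?_ X, aeval_X_left_apply]
    intro e he i
    have h1 : e i ≤ (Q n).totalDegree := (monomial_le_degreeOf i he).trans (degreeOf_le_totalDegree _ _)
    have h2 : M n < 2 ^ Nat.size (M n) := Nat.lt_size_self _
    have h3 : 2 ^ Nat.size (M n) < 2 ^ δ n := Nat.pow_lt_pow_right (by norm_num) (by simp [δ])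
    have h4 : (Q n).totalDegree < M n := by simp only [M]; omega
    omega
  rw [key]
  exact hVNP.aeval g hQ.1 hgd hgc

end Criterion

/-! ## §3  Format bridge: `IsCoeffDefinableIn PPoly → HasCoeffFnIn PPoly` -/

section Bridge

open CodeFP

variable (k : Type*) [CommRing k]

/-- Input type of a multivariate coefficient query `(n, sparse code of e, a)`. -/
abbrev QIn : Type := ℕ × (List (ℕ × ℕ) × ℕ)

/-- Code of an index query `(n, sparse code of e)` in the `encCoeffIdx` format. -/
abbrev eIdx : ℕ × List (ℕ × ℕ) → List Bool := pairE natE (listE (pairE natE natE))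

/-- Code of a bit query `((n, sparse code of e), (j, b))` in the `encCoeffBitQuery` format. -/
abbrev eBit : (ℕ × List (ℕ × ℕ)) × (ℕ × Bool) → List Bool := pairE eIdx (pairE natE bitE)

/-- The index-query translation `(n, l, a) ↦ (n, l)` is in `FP`. [folklore] -/
theorem codeFP_idx : CodeFP eOut eIdx (fun t : QIn => (t.1, t.2.1)) :=
  (CodeFP.pair (CodeFP.natOfUn.comp (CodeFP.fst _ _)) (CodeFP.snd _ _).fst').congr fun _ => rfl

/-- The bit-query translation `(n, l, a) ↦ ((n, l), (a - 1, true))` is in `FP`. [folklore] -/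
theorem codeFP_bit : CodeFP eOut eBit (fun t : QIn => ((t.1, t.2.1), (t.2.2 - 1, true))) :=
  (CodeFP.pair codeFP_idx (CodeFP.pair
    (CodeFP.natSub.comp (CodeFP.pair (CodeFP.snd _ _).snd' (CodeFP.const _ 1)))
    (CodeFP.const _ true))).congr fun _ => rfl

/-- The tag `(n, l, a) ↦ [a ≠ 0]` is in `FP`. [folklore] -/
theorem codeFP_tag : CodeFP eOut bitE (fun t : QIn => !decide (t.2.2 = 0)) :=
  (CodeFP.natEq.comp (CodeFP.pair (CodeFP.snd _ _).snd' (CodeFP.const _ 0))).not.congr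
    fun _ => rfl

/-- `eIdx` renders `encCoeffIdx`. -/
theorem eIdx_eq_encCoeffIdx {uu : ℕ} (n : ℕ) (e : Fin uu →₀ ℕ) :
    eIdx (n, sparseList (e.mapDomain Encodable.encode)) = encCoeffIdx n e := by
  show boolPair (natE n) (listE (pairE natE natE) _) =
    boolPair (Computability.encodeNat n) (encMonomial e)
  rw [encMonomial, CodeFP.listE_eq, CodeFP.pairE_eq]
  rfl

/-- `eBit` renders `encCoeffBitQuery`. -/
theorem eBit_eq_encCoeffBitQuery {uu : ℕ} (n : ℕ) (e : Fin uu →₀ ℕ) (j : ℕ) (b : Bool) :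
    eBit ((n, sparseList (e.mapDomain Encodable.encode)), (j, b)) = encCoeffBitQuery n e j b := by
  show boolPair (eIdx (n, sparseList (e.mapDomain Encodable.encode))) (boolPair (natE j) (bitE b)) = _
  rw [eIdx_eq_encCoeffIdx]
  rfl

/-- **Format bridge.**  If the sign and bit languages of `Q` (Koiran–Perifel format,
`IsCoeffDefinableIn`) lie in `P/poly`, then so does a language answering Bürgisser's queries
`expCoeffQuery n e a ↦ coeffFnBit Qₙ e a` (`a = 0`: the sign, read off the complement of the sign
language; `a = j + 1`: bit `j`, read off the bit language), assembled from two `FP`-translations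
and a polynomial-time tag by the Boolean closure of `P/poly`.
[cite: Burgisser2026HNC, Def. 4.2 (p. 11)] [cite: KoiranPerifel2007, Def. 1–2] -/
theorem hasCoeffFnIn_PPoly_of_isCoeffDefinableIn {u : ℕ → ℕ} {Q : ∀ n, MvPolynomial (Fin (u n)) ℤ}
    (h : IsCoeffDefinableIn PPoly Q) : HasCoeffFnIn PPoly Q := by
  classical
  obtain ⟨-, ⟨S, hS, hS'⟩, ⟨B, hB, hB'⟩⟩ := h
  obtain ⟨F₀, hF₀, hF₀'⟩ := codeFP_idx
  obtain ⟨F₁, hF₁, hF₁'⟩ := codeFP_bit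
  obtain ⟨G, hG, hG'⟩ := codeFP_tag
  -- the tag language `A = {w | G w = [true]}` is in `P ⊆ P/poly`
  let A : Language Bool := {w | G w = [true]}
  have hA : A ∈ PPoly := by
    refine P_subset_PPoly_holds (mem_P_of_mem_FP (comp_mem_FP Brick.isTrue1Fn_mem_FP hG) A fun w => ?_)
    constructor
    · intro hw
      have hw' : G w = [true] := hw
      simp [Function.comp_apply, Brick.isTrue1Fn_apply, hw']
    · intro hw
      have hw' : G w ≠ [true] := hw
      simp [Function.comp_apply, Brick.isTrue1Fn_apply, hw']
  have h1 : A ⊓ F₁ ⁻¹' B ∈ PPoly := inter_mem_PPoly hA (preimage_mem_PPoly hB hF₁)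
  have h0 : Aᶜ ⊓ F₀ ⁻¹' Sᶜ ∈ PPoly :=
    inter_mem_PPoly (compl_mem_PPoly hA) (preimage_mem_PPoly (compl_mem_PPoly hS) hF₀)
  refine ⟨((A ⊓ F₁ ⁻¹' B)ᶜ ⊓ (Aᶜ ⊓ F₀ ⁻¹' Sᶜ)ᶜ)ᶜ,
    compl_mem_PPoly (inter_mem_PPoly (compl_mem_PPoly h1) (compl_mem_PPoly h0)), ?_⟩
  intro n e a
  have hx : expCoeffQuery n e a = eOut (n, (sparseList (e.mapDomain Encodable.encode), a)) :=
    (eOut_eq_expCoeffQuery n a e).symm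
  have hmemA : expCoeffQuery n e a ∈ A ↔ a ≠ 0 := by
    show G (expCoeffQuery n e a) = [true] ↔ a ≠ 0
    rw [hx, hG']
    simp [bitE]
  have hmem : expCoeffQuery n e a ∈ ((A ⊓ F₁ ⁻¹' B)ᶜ ⊓ (Aᶜ ⊓ F₀ ⁻¹' Sᶜ)ᶜ)ᶜ ↔
      (expCoeffQuery n e a ∈ A ∧ F₁ (expCoeffQuery n e a) ∈ B) ∨
        (expCoeffQuery n e a ∉ A ∧ F₀ (expCoeffQuery n e a) ∉ S) := by
    show ¬ (¬ (_ ∧ _) ∧ ¬ (¬ _ ∧ ¬ _)) ↔ _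
    tauto
  rw [hmem, hmemA]
  cases a with
  | zero =>
    rw [hx, hF₀']
    dsimp only
    rw [eIdx_eq_encCoeffIdx, hS' n e]
    show _ ↔ decide (coeff e (Q n) < 0) = true
    simp
  | succ j =>
    rw [hx, hF₁']
    dsimp only
    rw [Nat.add_sub_cancel, eBit_eq_encCoeffBitQuery, hB' n e j true]
    show _ ↔ (coeff e (Q n)).natAbs.testBit j = true
    simp

/-- A finite bit budget for one polynomial: all coefficients of `f` have absolute value `< 2^b`
for `b = 1 + Σ_{e ∈ supp f} |coeff_e f|`. [folklore] -/
theorem natAbs_coeff_lt_two_pow_sum {σ : Type*} (f : MvPolynomial σ ℤ) (e : σ →₀ ℕ) :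
    (coeff e f).natAbs < 2 ^ (∑ e' ∈ f.support, (coeff e' f).natAbs + 1) := by
  refine lt_of_lt_of_le ?_ (Nat.lt_two_pow_self).le
  by_cases he : e ∈ f.support
  · have := Finset.single_le_sum (f := fun e' => (coeff e' f).natAbs) (fun _ _ => Nat.zero_le _) he
    exact Nat.lt_succ_of_le this
  · rw [notMem_support_iff.1 he]
    simp

/-- **Valiant's criterion, `P/poly` coefficients, Koiran–Perifel format.**  A p-family of integer
polynomials that is coefficient-definable in `P/poly` (`IsCoeffDefinableIn PPoly`: polynomial
bitsize, sign and bit languages in `P/poly`) is in `VNP` over every commutative ring.  This is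
the hypothesis shape `hVC` of `Theorems/DefinabilityGapCHCut.lean`, for `Fin`-indexed families.
[cite: Burgisser2000, Prop. 2.20] [cite: KoiranPerifel2007, Def. 1–2] [cite: Tavenas2014, Prop. 3.17] -/
theorem isVNPFamily_map_of_isCoeffDefinableIn_PPoly {u : ℕ → ℕ}
    {Q : ∀ n, MvPolynomial (Fin (u n)) ℤ} (hQ : IsPFamily Q) (h : IsCoeffDefinableIn PPoly Q) :
    IsVNPFamily fun n => map (Int.castRingHom k) (Q n) := by
  classical
  refine isVNPFamily_map_of_hasCoeffFnIn_PPoly k hQ ?_ (hasCoeffFnIn_PPoly_of_isCoeffDefinableIn h)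
  obtain ⟨c, hc⟩ := h.1
  -- bit budget: `n^c + 1` for `n > 1`, a finite budget at `n = 0, 1`
  let b : ℕ → ℕ := fun n => ∑ e' ∈ (Q n).support, (coeff e' (Q n)).natAbs + 1
  refine ⟨fun n => n ^ c + 1 + (b 0 + b 1), IsPBounded.add_holds (IsPBounded.add_holds
    (IsPBounded.pow_holds IsPBounded.id c) (IsPBounded.const 1)) (IsPBounded.const _), fun n e => ?_⟩
  by_cases hn : 1 < n
  · have h1 : |coeff e (Q n)| ≤ 2 ^ n ^ c := hc n hn e
    have h2 : ((coeff e (Q n)).natAbs : ℤ) ≤ 2 ^ n ^ c := by rwa [Int.natCast_natAbs]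
    have h3 : (coeff e (Q n)).natAbs ≤ 2 ^ n ^ c := by exact_mod_cast h2
    calc (coeff e (Q n)).natAbs ≤ 2 ^ n ^ c := h3
      _ < 2 ^ (n ^ c + 1 + (b 0 + b 1)) := Nat.pow_lt_pow_right (by norm_num) (by omega)
  · have hb : (coeff e (Q n)).natAbs < 2 ^ b n := natAbs_coeff_lt_two_pow_sum (Q n) e
    have hn' : n = 0 ∨ n = 1 := by omega
    refine hb.trans_le (Nat.pow_le_pow_right two_pos ?_)
    rcases hn' with rfl | rfl
    · exact (Nat.le_add_right (b 0) (b 1)).trans (Nat.le_add_left _ _)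
    · exact (Nat.le_add_left (b 1) (b 0)).trans (Nat.le_add_left _ _)

end Bridge

end Summit.ValiantsHypothesis.ValiantsHypothesis.Theorems.VPBoundarySquareValiantCriterionPPoly
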